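import Mathlib.Analysis.Calculus.SmoothSeries
import Mathlib.Analysis.Calculus.IteratedDeriv.Lemmas
import Mathlib.Analysis.Calculus.ContDiff.Deriv
import Mathlib.MeasureTheory.Integral.DominatedConvergence
import Mathlib.MeasureTheory.Integral.Bochner.Set
import HarnessLib

/-!
# Series of smooth functions with a common compact support: smoothness, support, term-wise
# derivatives, and testing the partial sums against a continuous function — PROVED

Topic `Literature/Analysis/Calculus`; namespace `Literature.Analysis.Calculus`.  Theorems only
(no definition, no named fact); Mathlib-only imports.

The packaging lemma behind "`h := Σ_j (−1)^j b_j C_j` is a test function and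
`∫ (Σ_{j<n} …)(y) φ(x − y) dy → ∫ h(y) φ(x − y) dy`" in the construction of the Dixmier–Malliavin kernel
on `ℝ` ([cite: Hegde2021, §3.2, proof of Lemma 14 ("`Σ_{j≤m} (−1)^j b_j f^{(2j)}` converges to a smooth
function on `|x| > 1` as `m → ∞`")]; [DixmierMalliavin1978, §2]): given `F : ℕ → ℝ → ℂ` smooth,
all supported in `[−R, R]`, with `‖F_j^{(m)}(x)‖ ≤ A m j` and `Σ_j A m j < ∞` for every `m`,

* `contDiff_tsum_of_norm_iteratedDeriv_le` — `x ↦ Σ' F_j(x)` is `C^∞` (Mathlib `contDiff_tsum`);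
* `iteratedDeriv_tsum_of_norm_iteratedDeriv_le` — `(Σ' F_j)^{(m)}(x) = Σ' F_j^{(m)}(x)`
  (induction with Mathlib `deriv_tsum_apply`); `norm_iteratedDeriv_tsum_le` — `≤ Σ' A m j`;
* `tsupport_tsum_subset`, `hasCompactSupport_tsum` — support in `[−R, R]`;
* `tendsto_integral_sum_mul_comp_sub` — for `φ` continuous and every `x`,
  `∫ (Σ_{j<n} F_j(y)) φ(x − y) dy → ∫ (Σ' F_j(y)) φ(x − y) dy` (dominated convergence with the
  dominator `(Σ' A 0 j) · sup_{[−R,R]} |φ(x − ·)|` on `[−R, R]`).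

Companion of `Literature/Analysis/Convolution/DixmierMalliavin*.lean` (Module A part III consumes it
with `F_j = (−1)^j b_j ((ωψ)^{(2j)} − ωψ^{(2j)})`, `R = 2`).
-/

noncomputable section

open Set Filter MeasureTheory Function
open scoped Topology ContDiff

namespace Literature.Analysis.Calculus

variable {F : ℕ → ℝ → ℂ} {A : ℕ → ℕ → ℝ} {R : ℝ}

/-- **Smoothness of the series.** If every `F j` is smooth and `‖F_j^{(m)}(x)‖ ≤ A m j` with
`Σ_j A m j < ∞` for all `m`, then `x ↦ Σ' F_j(x)` is smooth. [cite: Hegde2021, §3.2, proof of Lemma 14] -/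
theorem contDiff_tsum_of_norm_iteratedDeriv_le (hF : ∀ j, ContDiff ℝ ∞ (F j))
    (hA : ∀ m j x, ‖iteratedDeriv m (F j) x‖ ≤ A m j) (hsum : ∀ m, Summable (A m)) :
    ContDiff ℝ ∞ fun x => ∑' j, F j x :=
  contDiff_tsum (N := (⊤ : ℕ∞)) hF (fun m _ => hsum m) fun m j x _ => by
    rw [norm_iteratedFDeriv_eq_norm_iteratedDeriv]; exact hA m j x

/-- **Term-wise iterated derivatives.** Under the same hypotheses,
`(Σ' F_j)^{(m)}(x) = Σ' F_j^{(m)}(x)` (as functions). [cite: Hegde2021, §3.2, proof of Lemma 14] -/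
theorem iteratedDeriv_tsum_of_norm_iteratedDeriv_le (hF : ∀ j, ContDiff ℝ ∞ (F j))
    (hA : ∀ m j x, ‖iteratedDeriv m (F j) x‖ ≤ A m j) (hsum : ∀ m, Summable (A m)) (m : ℕ) :
    iteratedDeriv m (fun x => ∑' j, F j x) = fun x => ∑' j, iteratedDeriv m (F j) x := by
  induction m with
  | zero => simp
  | succ m ih =>
    rw [iteratedDeriv_succ, ih]
    funext x
    have hdiff : ∀ j, Differentiable ℝ (iteratedDeriv m (F j)) := fun j =>
      (hF j).differentiable_iteratedDeriv m (by exact_mod_cast ENat.coe_lt_top m)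
    have hbd : ∀ j y, ‖deriv (iteratedDeriv m (F j)) y‖ ≤ A (m + 1) j := fun j y => by
      rw [← iteratedDeriv_succ]; exact hA (m + 1) j y
    have h0 : Summable fun j => iteratedDeriv m (F j) x :=
      .of_norm_bounded (hsum m) fun j => hA m j x
    rw [deriv_tsum_apply (hsum (m + 1)) hdiff hbd h0 x]
    simp_rw [← iteratedDeriv_succ]

/-- **Bound for the derivatives of the series**: `‖(Σ' F_j)^{(m)}(x)‖ ≤ Σ' A m j`.
[cite: Hegde2021, §3.2, proof of Lemma 14] -/
theorem norm_iteratedDeriv_tsum_le (hF : ∀ j, ContDiff ℝ ∞ (F j))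
    (hA : ∀ m j x, ‖iteratedDeriv m (F j) x‖ ≤ A m j) (hsum : ∀ m, Summable (A m)) (m : ℕ)
    (x : ℝ) : ‖iteratedDeriv m (fun x => ∑' j, F j x) x‖ ≤ ∑' j, A m j := by
  rw [iteratedDeriv_tsum_of_norm_iteratedDeriv_le hF hA hsum m]
  exact tsum_of_norm_bounded (hsum m).hasSum fun j => hA m j x

/-- **Support of the series**: if every `F j` is supported in `[−R, R]`, so is `Σ' F_j`
("for some test function `h` supported in `[−2, 2]`", [cite: Hegde2021, §3.2, Lemma 14 and its proof]). -/
theorem tsupport_tsum_subset (hsupp : ∀ j, tsupport (F j) ⊆ Icc (-R) R) :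
    tsupport (fun x => ∑' j, F j x) ⊆ Icc (-R) R := by
  refine closure_minimal (fun x hx => ?_) isClosed_Icc
  by_contra hxK
  refine hx ?_
  have : ∀ j, F j x = 0 := fun j => image_eq_zero_of_notMem_tsupport fun h => hxK (hsupp j h)
  simp [this]

/-- The series vanishes off `[−R, R]` ("for `|x| ≥ 2` the entire sequence is zero",
[cite: Hegde2021, §3.2, proof of Lemma 14]). -/
theorem tsum_eq_zero_of_notMem (hsupp : ∀ j, tsupport (F j) ⊆ Icc (-R) R) {x : ℝ}
    (hx : x ∉ Icc (-R) R) : ∑' j, F j x = 0 := by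
  have : ∀ j, F j x = 0 := fun j => image_eq_zero_of_notMem_tsupport fun h => hx (hsupp j h)
  simp [this]

/-- **Compact support of the series** ("some test function `h` supported in `[−2, 2]`",
[cite: Hegde2021, §3.2, Lemma 14]). -/
theorem hasCompactSupport_tsum (hsupp : ∀ j, tsupport (F j) ⊆ Icc (-R) R) :
    HasCompactSupport fun x => ∑' j, F j x :=
  HasCompactSupport.intro isCompact_Icc fun _ hx => tsum_eq_zero_of_notMem hsupp hx

/-- **Testing the partial sums against a continuous function** (dominated convergence): for every
continuous `φ` and every `x`, `∫ (Σ_{j<n} F_j(y)) φ(x − y) dy → ∫ (Σ' F_j(y)) φ(x − y) dy`; only the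
order-`0` bounds `‖F_j(y)‖ ≤ A₀ j`, `Σ A₀ j < ∞`, and the common support `[−R, R]` are used.
[cite: Hegde2021, §3.2–3.3, proof of Lemma 14 / Theorem 18 (the limit `→ δ + h` in `𝒟′`)] -/
theorem tendsto_integral_sum_mul_comp_sub {A₀ : ℕ → ℝ} (hF : ∀ j, Continuous (F j))
    (hsupp : ∀ j, tsupport (F j) ⊆ Icc (-R) R) (hA : ∀ j x, ‖F j x‖ ≤ A₀ j) (hsum : Summable A₀)
    {φ : ℝ → ℂ} (hφ : Continuous φ) (x : ℝ) :
    Tendsto (fun n => ∫ y, (∑ j ∈ Finset.range n, F j y) * φ (x - y)) atTop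
      (𝓝 (∫ y, (∑' j, F j y) * φ (x - y))) := by
  -- a bound for `φ (x - ·)` on `[-R, R]`
  obtain ⟨M, hM⟩ : ∃ M, ∀ y ∈ Icc (-R) R, ‖φ (x - y)‖ ≤ M :=
    isCompact_Icc.exists_bound_of_continuousOn ((hφ.comp (continuous_const.sub continuous_id)).continuousOn)
  have hM0 : ∀ y ∈ Icc (-R) R, 0 ≤ M := fun y hy => (norm_nonneg _).trans (hM y hy)
  set S : ℝ := ∑' j, A₀ j with hS
  have hA0 : ∀ j, 0 ≤ A₀ j := fun j => (norm_nonneg _).trans (hA j 0)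
  have hzero : ∀ j y, y ∉ Icc (-R) R → F j y = 0 := fun j y hy =>
    image_eq_zero_of_notMem_tsupport fun h => hy (hsupp j h)
  -- dominated convergence
  refine tendsto_integral_of_dominated_convergence (fun y => (Icc (-R) R).indicator (fun _ => S * M) y)
    (fun n => ?_) ?_ (fun n => Eventually.of_forall fun y => ?_) (Eventually.of_forall fun y => ?_)
  · exact ((continuous_finsetSum _ fun j _ => hF j).mul
      (hφ.comp (continuous_const.sub continuous_id))).aestronglyMeasurable
  · exact (integrableOn_const (μ := volume) (s := Icc (-R) R) (C := (S * M : ℝ))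
      (measure_Icc_lt_top.ne)).integrable_indicator measurableSet_Icc
  · by_cases hy : y ∈ Icc (-R) R
    · rw [indicator_of_mem hy, norm_mul]
      have h1 : ‖∑ j ∈ Finset.range n, F j y‖ ≤ S :=
        (norm_sum_le _ _).trans ((Finset.sum_le_sum fun j _ => hA j y).trans
          (hsum.sum_le_tsum _ fun j _ => hA0 j))
      exact mul_le_mul h1 (hM y hy) (norm_nonneg _) ((norm_nonneg _).trans h1)
    · rw [indicator_of_notMem hy]
      simp [Finset.sum_eq_zero (fun j _ => hzero j y hy)]
  · have hs : HasSum (fun j => F j y) (∑' j, F j y) :=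
      (Summable.of_norm_bounded hsum fun j => hA j y).hasSum
    exact (hs.tendsto_sum_nat).mul_const _

end Literature.Analysis.Calculus
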